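import Summits.FinalStateConjecture.FinalStateConjecture.Theorems.RecurrentKerrEraWithBudgets.Negative.LeafDevDilationDegeneracy
import Literature.Geometry.Lorentzian.KerrConvergenceProofs
import Literature.Geometry.Lorentzian.KerrWaveDecay
import Literature.Geometry.Lorentzian.KerrSchildCoord
import Literature.Geometry.Lorentzian.FramedBilinEstimates

/-!
# `Cᵏ` boundedness of the Kerr–Schild components on `{r > M}` and the UNCONDITIONAL
# dichotomy `leafDev ∈ {0, ∞}`

Negative-lane helper for the crux `KillingDefectSpacetimeBound.DefectCoercivity`
(item `stmt-FinalStateConjecture-18632`); it asserts NO decl of the route file.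

The landed negative lemmas on the LE-weighted leaf deviation `Spacetime.leafDev`
(`…RecurrentKerrEraWithBudgets.Negative.leafDev_eq_zero_or_top`, p172618;
`…SquareIntegrableCapture.Negative.leafDev_eq_zero`; `…DefectCoercivity.Negative.leafDev_minkowski_eq_zero`,
p172967) all carry a finiteness hypothesis on the unweighted `Cᵏ` size of the Kerr–Schild components
`g_{M,a}` over the measured set ("textbook"). This file PROVES that hypothesis once and for all
(`supCkENorm_region_bilin_lt_top`: for every order `k`, every `M > 0` and EVERY spin `a`, the `Cᵏ`
components of `g_{M,a}` are bounded on `{r(a,·) > M}`) and records the resulting unconditional facts: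

* `leafDev_zero_or_top` — `𝓢.leafDev M₀ a₀ Ψ χ k τ = 0 ∨ = ⊤` for ALL arguments (any spacetime, any
  chart map `Ψ`, any margin `χ`, any order, any leaf);
* `leafDev_le_ofReal_iff_ne_top` — a clause `leafDev ≤ ENNReal.ofReal δ` says exactly `leafDev ≠ ⊤`;
* `leafDev_eq_zero_of_le_ofReal` — a finite bound at order `k'` forces `leafDev = 0` at every order `k ≤ k'`;
* `leafDev_eq_zero_of_window` — the window hypothesis of `DefectCoercivity` / `stub_oscillationRigidity`
  (`∀ τ ∈ [τ₁, τ₁+L], leafDev (k+2) τ ≤ ofReal δ₀`, `L ≥ 0`) forces `leafDev k σ = 0` at every `σ` of the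
  middle half — so both conclusions hold with constant `0`, using none of the Einstein / foliation hypotheses
  (the kernel-checked junk proof of the crux itself is attached to the item as evidence, not landed);
* `recurrence_iff_frequently_finite'` — the recurrence clause of `RecurrentKerrEraWithBudgets`, unconditionally.

Proof of the bound: far out (`r ≥ R`, `R` from `Kerr.norm_iteratedFDeriv_ksPert_le`) every derivative of
`g_{M,a} − η` is `≤ C/r ≤ |C|/R` and `η` is constant; on `M < r ≤ R` translate to `t* = 0` by stationarity
(`Kerr.bilin_add_smul_basisVector_zero`, `iteratedFDeriv_comp_add_right`) and use continuity of
`iteratedFDeriv` on the compact `{t* = 0, M ≤ r ≤ R} ⊆ {r > M/2}` (`Kerr.contDiffAt_bilin`).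
Relocation hint: the first three declarations are pure Kerr–Schild facts
[topic Geometry.Lorentzian.KerrSchildCoord].
-/

open Set Filter Function Topology
open scoped ContDiff ENNReal Manifold

noncomputable section

namespace Summit.FinalStateConjecture.FinalStateConjecture.Theorems.DefectCoercivity.Negative

open Literature.Geometry.Lorentzian
open Summit.FinalStateConjecture.FinalStateConjecture.Theorems.RecurrentKerrEraWithBudgets.Negative

universe u



/-- Points of `E4` with time `0` and Kerr–Schild radius in `[M, R]` form a compact set. [folklore] -/
theorem isCompact_timeZero_radius_Icc (a M R : ℝ) :
    IsCompact {x : E4 | x 0 = 0 ∧ M ≤ Kerr.radius a x ∧ Kerr.radius a x ≤ R} := by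
  refine Metric.isCompact_of_isClosed_isBounded ?_ ?_
  · refine (isClosed_eq ?_ continuous_const).inter
      ((isClosed_le continuous_const (Kerr.continuous_radius a)).inter
        (isClosed_le (Kerr.continuous_radius a) continuous_const))
    fun_prop
  · rw [isBounded_iff_forall_norm_le]
    refine ⟨|R| + |a|, fun x hx ↦ ?_⟩
    obtain ⟨h0, -, hR⟩ := hx
    have h1 : E4.spatialNorm x ^ 2 - a ^ 2 ≤ Kerr.radius a x ^ 2 :=
      Kerr.spatialNorm_sq_sub_sq_le_radius_sq a x
    have h2 : ‖x‖ ^ 2 = x 0 ^ 2 + E4.spatialNorm x ^ 2 := by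
      rw [EuclideanSpace.real_norm_sq_eq, E4.spatialNorm_sq, Fin.sum_univ_four]
      ring
    have hr0 : 0 ≤ Kerr.radius a x := Kerr.radius_nonneg a x
    have h3 : Kerr.radius a x ≤ |R| := hR.trans (le_abs_self R)
    have h4 : ‖x‖ ^ 2 ≤ (|R| + |a|) ^ 2 := by
      rw [h2, h0]
      nlinarith [abs_nonneg R, abs_nonneg a, sq_abs a, mul_self_le_mul_self hr0 h3]
    exact le_of_pow_le_pow_left₀ two_ne_zero (by positivity) h4

set_option synthInstance.maxHeartbeats 400000 in
/-- Per-order bound of the Kerr–Schild components on `{r > M}`, `M > 0`. [folklore] -/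
theorem exists_bound_iteratedFDeriv_bilin (m : ℕ) {M : ℝ} (hM : 0 < M) (a : ℝ) :
    ∃ Θ : ℝ, ∀ x ∈ (Kerr.region a M : Set E4), ‖iteratedFDeriv ℝ m (Kerr.bilin M a) x‖ ≤ Θ := by
  obtain ⟨C, R, hR, hfar⟩ := Kerr.norm_iteratedFDeriv_ksPert_le M a m
  set mink : E4 →L[ℝ] E4 →L[ℝ] ℝ := Minkowski.bilin with hmink
  -- near part: the compact set at time zero
  set K : Set E4 := {x | x 0 = 0 ∧ M ≤ Kerr.radius a x ∧ Kerr.radius a x ≤ R} with hK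
  have hKc : IsCompact K := isCompact_timeZero_radius_Icc a M R
  have hKs : K ⊆ (Kerr.region a (M / 2) : Set E4) := fun x hx ↦ by
    rw [SetLike.mem_coe, Kerr.mem_region, max_eq_left (by linarith : (0 : ℝ) ≤ M / 2)]
    linarith [hx.2.1]
  have hsmooth : ContDiffOn ℝ m (Kerr.bilin M a) (Kerr.region a (M / 2) : Set E4) := fun x hx ↦
    (Kerr.contDiffAt_bilin M a (Kerr.radius_pos_of_mem_region hx)).contDiffWithinAt
  obtain ⟨Θ₁, -, hΘ₁⟩ :=
    exists_bound_iteratedFDeriv_le_of_isCompact (Kerr.region a (M / 2)).isOpen hsmooth hKc hKs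
  refine ⟨max Θ₁ (|C| / R + ‖mink‖), fun x hx ↦ ?_⟩
  have hrM : M < Kerr.radius a x := Kerr.lt_radius_of_mem_region hx
  rcases le_or_gt R (Kerr.radius a x) with hxR | hxR
  · -- far zone: `g = (g − η) + η`
    refine le_trans ?_ (le_max_right _ _)
    have hr0 : 0 < Kerr.radius a x := hR.trans_le hxR
    have hCM : ContDiffAt ℝ m (Kerr.bilin M a) x := Kerr.contDiffAt_bilin M a hr0
    have hconst : ContDiffAt ℝ m (fun _ : E4 ↦ mink) x := contDiffAt_const
    have hsub : iteratedFDeriv ℝ m (fun y ↦ Kerr.bilin M a y - mink) x =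
        iteratedFDeriv ℝ m (Kerr.bilin M a) x - iteratedFDeriv ℝ m (fun _ : E4 ↦ mink) x :=
      iteratedFDeriv_sub_apply hCM hconst
    have hsplit : iteratedFDeriv ℝ m (Kerr.bilin M a) x =
        iteratedFDeriv ℝ m (fun y ↦ Kerr.bilin M a y - mink) x +
          iteratedFDeriv ℝ m (fun _ : E4 ↦ mink) x := by
      rw [hsub, sub_add_cancel]
    have hc : ‖iteratedFDeriv ℝ m (fun _ : E4 ↦ mink) x‖ ≤ ‖mink‖ := by
      rcases Nat.eq_zero_or_pos m with rfl | hm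
      · simp
      · have h0 : iteratedFDeriv ℝ m (fun _ : E4 ↦ mink) = 0 := iteratedFDeriv_const_of_ne hm.ne' mink
        rw [h0, Pi.zero_apply, norm_zero]
        exact norm_nonneg mink
    have h1 : ‖iteratedFDeriv ℝ m (fun y ↦ Kerr.bilin M a y - mink) x‖ ≤ |C| / R :=
      calc (‖iteratedFDeriv ℝ m (fun y ↦ Kerr.bilin M a y - mink) x‖ : ℝ)
          ≤ C / Kerr.radius a x := hfar x hxR
        _ ≤ |C| / Kerr.radius a x := div_le_div_of_nonneg_right (le_abs_self C) hr0.le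
        _ ≤ |C| / R := div_le_div_of_nonneg_left (abs_nonneg C) hR hxR
    calc ‖iteratedFDeriv ℝ m (Kerr.bilin M a) x‖
        ≤ ‖iteratedFDeriv ℝ m (fun y ↦ Kerr.bilin M a y - mink) x‖ +
            ‖iteratedFDeriv ℝ m (fun _ : E4 ↦ mink) x‖ := by
          rw [hsplit]
          exact norm_add_le _ _
      _ ≤ |C| / R + ‖mink‖ := add_le_add h1 hc
  · -- near zone: translate to time zero (stationarity) and use the compact bound
    refine le_trans ?_ (le_max_left _ _)
    set x' : E4 := x + (-(x 0)) • E4.basisVector 0 with hx'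
    have hrad : Kerr.radius a x' = Kerr.radius a x := Kerr.radius_add_time_smul_basisVector a x _
    have hx'0 : x' 0 = 0 := by simp [hx', E4.basisVector]
    have hx'K : x' ∈ K := ⟨hx'0, by rw [hrad]; exact hrM.le, by rw [hrad]; exact hxR.le⟩
    have htrans : iteratedFDeriv ℝ m (Kerr.bilin M a) x = iteratedFDeriv ℝ m (Kerr.bilin M a) x' := by
      have hfun : (fun z ↦ Kerr.bilin M a (z + (x 0) • E4.basisVector 0)) = Kerr.bilin M a :=
        funext fun z ↦ Kerr.bilin_add_smul_basisVector_zero M a z (x 0)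
      have h := iteratedFDeriv_comp_add_right (𝕜 := ℝ) (f := Kerr.bilin M a) m
        ((x 0) • E4.basisVector 0) x'
      rw [hfun] at h
      rw [h, hx', neg_smul, neg_add_cancel_right]
    rw [htrans]
    exact hΘ₁ m le_rfl x' hx'K

/-- **`HKerrCk` holds**: the `Cᵏ` components of `g_{M,a}` are bounded on `{r(a,·) > M}` for every
order `k`, every `M > 0` and every `a` (Kerr–Schild 1965, §2). [folklore] -/
theorem supCkENorm_region_bilin_lt_top (k : ℕ) {M : ℝ} (hM : 0 < M) (a : ℝ) :
    supCkENorm (Kerr.region a M : Set E4) k (Kerr.bilin M a) < ⊤ := by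
  choose th hth using fun m ↦ exists_bound_iteratedFDeriv_bilin m hM a
  set Θ : ℝ := ∑ m ∈ Finset.range (k + 1), |th m| with hΘdef
  have hΘ : ∀ m ≤ k, ∀ x ∈ (Kerr.region a M : Set E4),
      ‖iteratedFDeriv ℝ m (Kerr.bilin M a) x‖ ≤ Θ := by
    intro m hm x hx
    calc ‖iteratedFDeriv ℝ m (Kerr.bilin M a) x‖ ≤ th m := hth m x hx
      _ ≤ |th m| := le_abs_self _
      _ ≤ Θ := Finset.single_le_sum (f := fun m ↦ |th m|) (fun i _ ↦ abs_nonneg _)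
          (Finset.mem_range.2 (Nat.lt_succ_of_le hm))
  have hle : supCkENorm (Kerr.region a M : Set E4) k (Kerr.bilin M a) ≤ ENNReal.ofReal Θ := by
    unfold supCkENorm
    refine iSup₂_le fun m hm ↦ iSup₂_le fun x hx ↦ ?_
    rw [← ofReal_norm]
    exact ENNReal.ofReal_le_ofReal (hΘ m hm x hx)
  exact hle.trans_lt ENNReal.ofReal_lt_top


/-! ### The dichotomy is unconditional; smallness of `leafDev` is decorative -/

/-- **`leafDev ∈ {0, ∞}` unconditionally**: the hypothesis `hKerr` of
`RecurrentKerrEraWithBudgets.Negative.leafDev_eq_zero_or_top` discharged by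
`supCkENorm_region_bilin_lt_top` (no restriction on the margin `χ`). [folklore] -/
theorem leafDev_zero_or_top {𝓢 : Spacetime.{u} 4} {M₀ a₀ : ℝ}
    {Ψ : (Kerr.hypStarBackground M₀ a₀).domain → 𝓢.carrier} {χ : ℝ} {k : ℕ} {τ : ℝ} :
    𝓢.leafDev M₀ a₀ Ψ χ k τ = 0 ∨ 𝓢.leafDev M₀ a₀ Ψ χ k τ = ⊤ :=
  leafDev_eq_zero_or_top fun _ a hM _ ↦ supCkENorm_region_bilin_lt_top k hM a

/-- `leafDev ≤ ofReal δ` carries exactly the information `leafDev ≠ ⊤` (for every real `δ`). [folklore] -/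
theorem leafDev_le_ofReal_iff_ne_top {𝓢 : Spacetime.{u} 4} {M₀ a₀ : ℝ}
    {Ψ : (Kerr.hypStarBackground M₀ a₀).domain → 𝓢.carrier} {χ : ℝ} {k : ℕ} {τ δ : ℝ} :
    𝓢.leafDev M₀ a₀ Ψ χ k τ ≤ ENNReal.ofReal δ ↔ 𝓢.leafDev M₀ a₀ Ψ χ k τ ≠ ⊤ := by
  constructor
  · exact fun h ↦ (h.trans_lt ENNReal.ofReal_lt_top).ne
  · intro h
    rcases leafDev_zero_or_top (𝓢 := 𝓢) (M₀ := M₀) (a₀ := a₀) (Ψ := Ψ) (χ := χ) (k := k) (τ := τ)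
      with h' | h'
    · rw [h']; exact bot_le
    · exact absurd h' h

/-- A finite bound on `leafDev` at order `k'` forces `leafDev = 0` at every order `k ≤ k'`. [folklore] -/
theorem leafDev_eq_zero_of_le_ofReal {𝓢 : Spacetime.{u} 4} {M₀ a₀ : ℝ}
    {Ψ : (Kerr.hypStarBackground M₀ a₀).domain → 𝓢.carrier} {χ : ℝ} {k k' : ℕ} (hk : k ≤ k') {τ δ : ℝ}
    (h : 𝓢.leafDev M₀ a₀ Ψ χ k' τ ≤ ENNReal.ofReal δ) : 𝓢.leafDev M₀ a₀ Ψ χ k τ = 0 := by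
  have h0 : 𝓢.leafDev M₀ a₀ Ψ χ k' τ = 0 := by
    rcases leafDev_zero_or_top (𝓢 := 𝓢) (M₀ := M₀) (a₀ := a₀) (Ψ := Ψ) (χ := χ) (k := k') (τ := τ)
      with h' | h'
    · exact h'
    · rw [h'] at h
      exact absurd h (by simp)
  exact le_antisymm (h0 ▸ Spacetime.leafDev_mono_right M₀ a₀ Ψ χ hk τ) bot_le

/-- **The window hypothesis of `DefectCoercivity` / `stub_oscillationRigidity` kills their left side**:
if `leafDev (k+2) ≤ ofReal δ₀` on `[τ₁, τ₁ + L]` (`L ≥ 0`), then `leafDev k σ = 0` for every `σ` in the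
middle half `[τ₁ + L/4, τ₁ + 3L/4]` — whence `leafDev k σ ^ 2 ≤ ENNReal.ofReal 0 * R` for ANY right side `R`.
None of `admissibleVacuumData`, `IsHypKerrFoliation`, `τ₀ ≤ τ₁` is involved. [folklore] -/
theorem leafDev_eq_zero_of_window {𝓢 : Spacetime.{u} 4} {M₀ a₀ : ℝ}
    {Ψ : (Kerr.hypStarBackground M₀ a₀).domain → 𝓢.carrier} {χ : ℝ} {k : ℕ} {τ₁ L δ₀ σ : ℝ}
    (hwin : ∀ τ ∈ Icc τ₁ (τ₁ + L), 𝓢.leafDev M₀ a₀ Ψ χ (k + 2) τ ≤ ENNReal.ofReal δ₀) (hL : 0 ≤ L)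
    (hσ : σ ∈ Icc (τ₁ + L / 4) (τ₁ + 3 * L / 4)) : 𝓢.leafDev M₀ a₀ Ψ χ k σ = 0 :=
  leafDev_eq_zero_of_le_ofReal (by omega : k ≤ k + 2)
    (hwin σ ⟨by linarith [hσ.1], by linarith [hσ.2]⟩)

/-- Corollary in the exact shape of the two conclusions: with constant `0` and any right-hand side. -/
theorem leafDev_sq_le_zero_mul_of_window {𝓢 : Spacetime.{u} 4} {M₀ a₀ : ℝ}
    {Ψ : (Kerr.hypStarBackground M₀ a₀).domain → 𝓢.carrier} {χ : ℝ} {k : ℕ} {τ₁ L δ₀ σ : ℝ}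
    (hwin : ∀ τ ∈ Icc τ₁ (τ₁ + L), 𝓢.leafDev M₀ a₀ Ψ χ (k + 2) τ ≤ ENNReal.ofReal δ₀) (hL : 0 ≤ L)
    (hσ : σ ∈ Icc (τ₁ + L / 4) (τ₁ + 3 * L / 4)) (R : ℝ≥0∞) :
    𝓢.leafDev M₀ a₀ Ψ χ k σ ^ 2 ≤ ENNReal.ofReal 0 * R := by
  rw [leafDev_eq_zero_of_window hwin hL hσ]
  simp

/-- The recurrence clause of `RecurrentKerrEraWithBudgets`, unconditionally:
`(∀ ε > 0, ∃ᶠ τ, leafDev … τ ≤ ofReal ε) ↔ ∃ᶠ τ, leafDev … τ < ⊤`. [folklore] -/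
theorem recurrence_iff_frequently_finite' {𝓢 : Spacetime.{u} 4} {M₀ a₀ : ℝ}
    {Ψ : (Kerr.hypStarBackground M₀ a₀).domain → 𝓢.carrier} {χ : ℝ} {k : ℕ} :
    (∀ ε : ℝ, 0 < ε → ∃ᶠ τ in atTop, 𝓢.leafDev M₀ a₀ Ψ χ k τ ≤ ENNReal.ofReal ε) ↔
      ∃ᶠ τ in atTop, 𝓢.leafDev M₀ a₀ Ψ χ k τ < ⊤ :=
  recurrence_iff_frequently_finite fun _ a hM _ ↦ supCkENorm_region_bilin_lt_top k hM a

end Summit.FinalStateConjecture.FinalStateConjecture.Theorems.DefectCoercivity.Negative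

end
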